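import Summits.ValiantsHypothesis.ValiantsHypothesis.Theses.DivisionGap
import Summits.ValiantsHypothesis.ValiantsHypothesis.Theorems.DivisionGapPerDivisionHardFormulaSplit

/-!
# Line `formula-cofactor-split` — crux `stmt-ValiantsHypothesis-5065` (`DivisionGap.PerDivisionHard`)

Crux-strategist r1 (planner-cstrat-stmt-ValiantsHypothesis-5065-r1-0, 2026-08-17).  The MODEL-REDUCTION
line for H1, orthogonal to the three registered face/rigidity lines (pair-descent-jss-endpoint,
birkhoff-face-descent, typed-vertex-rectangles), which attack the crux head-on at circuit strength:

  `stub_perFormulaMultiplesHard` (formula strength, `h` uncharged)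
    → `stub_perCofactorDegreeReduction` (= crux item stmt-ValiantsHypothesis-15046)
    → `PerDivisionHard`                                   (`PerDivisionHard_of`, kernel-checked:
                                                          the landed `FormulaSplit.perDivisionHard_of_formulaSplit`, p167555).

Stub 1 is the NEW statement of this line: monotone fan-in-two FORMULAS over `ℝ≥0` computing a
nonzero multiple `per_n · h` are super-quasi-polynomial — HrubesYehudayoff2021 §6 Problem 2 at
formula strength for the permanent.  It is strictly WEAKER than both H1 engines already on the route
(`PerMultiplesHard ⇒ stub 1` by `L ≤ E`; `ShadowBirkhoff ⇒ stub 1` by HY21 Thm 42 for the tree's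
formula model — both PROVED in `Theorems/DivisionGapPerDivisionHardFormulaSplit.lean`), so it has
TWO independent engines: (E1) `σ(DS_n)` super-qp (crux `ShadowBirkhoff`, HY21 Open Problem 1), or
(E2) a `per`-specific monotone-FORMULA argument — torus reduction is free for formulas (the top
components of a monotone formula are computed by a sub-formula), face descent and JSS contraction as
in the circuit lines, then multi-factor rigidity of the log-product terms of a formula
(Hyafil / HrubesYehudayoff2011 decomposition: `≈ log d` factors of geometrically decreasing degree per
term) on a placed high-girth Birkhoff face; cf. the K2F chapter `stub_formulaRigid` of
pair-descent-jss-endpoint, whose formula hypothesis is on `h` — here it is on `per_n · h`, which is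
what E2 can exploit (every factor of every term is bounded by `per_F · top h`).
Stub 2 is the existing degree-reduction crux (its own lead and skeleton live under
`Cruxes/PerCofactorDegreeReduction/`).

Why this dodges the STUCK goal of the live line: the lead's open core (steered K2 =
`NoCheapOmnipresence`, crux-equivalent pair forms A–D) is a CIRCUIT-strength omnipresence statement
whose only missing engine is an "injectivity tax" structure theorem (dossier v8 §4b).  Engine E1 of
stub 1 needs no omnipresence statement at all (it is polytope geometry: `σ(DS_n)`); engine E2 still
needs a rigidity engine of the K2F kind (the one-scale-cut barrier applies to its one-scale reading:
`h_walk` has `n^{O(log L)}`-size formulas, v12/T9, so E2 must use steered weights like the circuit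
line) but works with more structure — a sum of `≤ s` products of `Θ(log d)` factors of the PRODUCT
`per_n·h`, no reuse; and the circuit-vs-formula gap is isolated in stub 2, a statement about
monotone computation in which `per_n` enters only through `Nat.log 2 (L₊(per_n·h))`.

Probes (folder `bc/PFMH_probe.lean`, `bc/PFMH_cruxprobe.lean`, lean rc as expected): stub 1 → summit,
stub 1 → crux, stub 2 → summit, stub 2 → crux, summit/crux → stub 1, `⊢ stub 1` all FAIL under
`exact? | simpa | aesop`; `#h21_crux_probe` VERDICT CLEAN for both stubs.  Neither stub is the crux
reworded: stub 1 is uncharged-formula (incomparable with the charged circuit crux in the tree; implied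
by the uncharged `PerMultiplesHard`), stub 2 is the refuter-certified C′ of 2026-08-16.
-/

noncomputable section

set_option linter.dupNamespace false

namespace Summit.ValiantsHypothesis.ValiantsHypothesis.Cruxes.PerDivisionHard.FormulaCofactorSplit

open scoped NNReal
open MvPolynomial
open Literature.Computability.AlgebraicComplexity
open Summit.ValiantsHypothesis.ValiantsHypothesis.Theses.DivisionGap

/-- **stub_perFormulaMultiplesHard (OPEN; the line's new statement = route piece
`PerFormulaMultiplesHard`).**  For every `c`, for all large `n`, every nonzero `h ∈ ℝ≥0[x_ij]` has
`2^{(log₂ n + c)^c} < E₊(per_n · h)`, `E₊ = formulaComplexity` over `ℝ≥0` (monotone fan-in-two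
formula size; `h` uncharged, `deg h ≤ E₊` automatically).  Engines: `ShadowBirkhoff`
(`FormulaSplit.perFormulaMultiplesHard_of_shadowBirkhoff`, landed) or a direct monotone-formula
rigidity argument (see the module docstring).  Known rungs: `h` constant (Jerrum–Snir), `h` a
monomial (JuknaSeiwertSergeev2022 Thm 1), every landed circuit rung of the crux a fortiori
(`L ≤ E`), and super-POLYNOMIAL for every `h ≠ 0` via `σ(DS_n) ≥ 2^{Ω(log² n)}` (HY21 Prop 23 +
Thm 42).  Why it might fail: both engines may fail — `σ(DS_n) = 2^{Θ(log² n)}` and a dense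
margin-homogeneous cofactor (walk sums, `per^k`-type) with a quasi-polynomial monotone formula for
`per_n · h`. [cite: HrubesYehudayoff2021, §6 Problem 2, Thm. 42, Open Problem 1] -/
theorem stub_perFormulaMultiplesHard :
    ∀ c : ℕ, ∃ n₀ : ℕ, ∀ n ≥ n₀, ∀ h : MvPolynomial (Fin n × Fin n) ℝ≥0, h ≠ 0 →
      2 ^ ((Nat.log 2 n + c) ^ c) < formulaComplexity (perPoly (Fin n) ℝ≥0 * h) := by
  sorry

/-- **stub_perCofactorDegreeReduction (OPEN; verbatim the route crux `PerCofactorDegreeReduction`,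
item stmt-ValiantsHypothesis-15046, staffed under `Cruxes/PerCofactorDegreeReduction/`).**  There is
`k` such that every nonzero `h` can be traded for a nonzero `h'` with
`deg h' ≤ 2^{(log₂ n + log₂ L₊(per_n·h) + k)^k}` and `L₊(per_n·h') ≤` the same bound.
Why it might fail: repeated-squaring cofactors `u^{2^j}·v` (HY21 Rem 45; Kaltofen factor extraction is
non-monotone). [cite: HrubesYehudayoff2021, Prop. 43(2), Rem. 45] -/
theorem stub_perCofactorDegreeReduction : PerCofactorDegreeReduction := by
  sorry

/-- **Composition (kernel-checked, no sorry): the two stubs give the crux BY NAME.**  This is the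
landed assembly `FormulaSplit.perDivisionHard_of_formulaSplit` (Theorems/
DivisionGapPerDivisionHardFormulaSplit.lean, p167555): failure of `PerMultiplesHard` at exponent `c`
plus degree reduction (`k`) plus Brent/Hyafil/VSBR balancing over the semiring `ℝ≥0`
(`formulaComplexity_le_two_pow`) yields a monotone FORMULA of size `2^{18E²} ≤ 2^{(log₂ n + c₂)^{c₂}}`
for some `per_n · h'`, `h' ≠ 0`, contradicting stub 1 at `c₂`; then `PerMultiplesHard →
PerDivisionHard` (`perMultiplesToDivision_proof`). [folklore] -/
theorem PerDivisionHard_of :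
    Summit.ValiantsHypothesis.ValiantsHypothesis.Theses.DivisionGap.PerDivisionHard :=
  Summit.ValiantsHypothesis.ValiantsHypothesis.Theorems.DivisionGap.FormulaSplit.perDivisionHard_of_formulaSplit
    stub_perFormulaMultiplesHard stub_perCofactorDegreeReduction

/-- Position of stub 1, engine E1 (landed): `ShadowBirkhoff` suffices. [cite: HrubesYehudayoff2021, Thm. 42] -/
theorem stub_perFormulaMultiplesHard_of_shadowBirkhoff (H : ShadowBirkhoff) :
    ∀ c : ℕ, ∃ n₀ : ℕ, ∀ n ≥ n₀, ∀ h : MvPolynomial (Fin n × Fin n) ℝ≥0, h ≠ 0 →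
      2 ^ ((Nat.log 2 n + c) ^ c) < formulaComplexity (perPoly (Fin n) ℝ≥0 * h) :=
  Summit.ValiantsHypothesis.ValiantsHypothesis.Theorems.DivisionGap.FormulaSplit.perFormulaMultiplesHard_of_shadowBirkhoff H

/-- Position of stub 1 (landed): it is implied by the uncharged crux `PerMultiplesHard`, so it is a
genuine WEAKENING of the H1 target, not a costume. [folklore] -/
theorem stub_perFormulaMultiplesHard_of_perMultiplesHard (H : PerMultiplesHard) :
    ∀ c : ℕ, ∃ n₀ : ℕ, ∀ n ≥ n₀, ∀ h : MvPolynomial (Fin n × Fin n) ℝ≥0, h ≠ 0 →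
      2 ^ ((Nat.log 2 n + c) ^ c) < formulaComplexity (perPoly (Fin n) ℝ≥0 * h) :=
  Summit.ValiantsHypothesis.ValiantsHypothesis.Theorems.DivisionGap.FormulaSplit.perFormulaMultiplesHard_of_perMultiplesHard H

end Summit.ValiantsHypothesis.ValiantsHypothesis.Cruxes.PerDivisionHard.FormulaCofactorSplit

end
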